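import Literature.LinearAlgebra.Matrix.GL2ZSingularNormalForms
import Literature.NumberTheory.ComplexMultiplication.FiniteQAlgebraLatticeSplitRankTwo
import HarnessLib

/-!
# Hertling–Larabi 2026b EXAMPLE 9.3: the `GL₂(ℤ)`-classes of integer `2 × 2` matrices with eigenvalues `λ ≠ 0` and
# `0`, STRATIFIED BY THEIR ORDER `Λ_α` (`α | λ`) — `⌈φ(α)/2⌉` classes of order `Λ_α`, and
# `Σ_{α | λ} ⌈φ(α)/2⌉ = ⌊|λ|/2⌋ + 1`

[topic LinearAlgebra/Matrix] Sequel to `GL2ZSingularNormalForms` (HL26b Thm. 9.4: the classes with `tr B = λ ≠ 0`,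
`det B = 0` have the unique representatives `(λ m; 0 0)`, `0 ≤ m ≤ ½|λ|`, `⌊|λ|/2⌋ + 1` of them; the order of the
class of `(λ m; 0 0)` is `ℤ·1 + ℤ·t̄/gcd(λ, m) ≅ Λ_{|λ|/gcd(λ,m)}`) and to
`NumberTheory/ComplexMultiplication/FiniteQAlgebraLatticeSplitRankTwo` (HL26b Thm. 9.1 (d): `|G([Λ_α]_ε)| = φ(α)/2`
for `α ≥ 3`, `1` for `α ≤ 2`, through the count `natCard_two_mul_le_coprime` of `{β | 2β ≤ α, gcd(α, β) = 1}`) —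
REUSED by name.  Lane `lit-hodgefound` (Track 2 foundations library), seat p19 generation 38, row g38-#8.  THEOREMS
ONLY: no definition, no instance, no notation, no named fact (D-0026, net Literature debt `0`), no `sorry`.

DEF-FREE SPELLING.  The ORDER INVARIANT of a class is carried by the CONTENT of its matrices: «the entries of `B` have
greatest common divisor `g`» is `∀ d : ℤ, (∀ i j, d ∣ B i j) ↔ d ∣ g`, a conjugation invariant
(`forall_dvd_iff_of_conj`); for the representative `(λ m; 0 0)` it says `gcd(λ, m) = g`, and by
`GL2ZSingularNormalForms.order_eq_span_of_normalForm` the order of the class is then `ℤ·1 + ℤ·t̄/g`, which is HL's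
`Λ_α`, `α = |λ|/g` (Thm. 9.4: «order with `ℤ`-basis `e(α 1; 0 1)` where `α = λ/(λ, μ)`»).

## Source, VERBATIM

C. Hertling, K. Larabi, *Conjugacy classes of regular integer matrices*, arXiv:2602.15748 (2026) [HertlingLarabi2026b],
held `paper:arxiv-2602.15748`, §9.2 (chunk p0028): «**Example 9.3.** Choose `λ ∈ ℕ`. By Theorem 6.3 the conjugacy
classes of integer `2×2` matrices with eigenvalues `λ` and `0` correspond to the `ε`-classes of full lattices `L`
with `𝒪(L) ⊃ Λ` where `Λ` is the order `Λ = ℤ[λe_1]`, so the order with `ℤ`-basis `e(λ 1; 0 1)`. By Theorem 9.1 (d)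
`{[L]_ε | 𝒪(L) ⊃ Λ} = ⋃_{α ∈ ℕ: α|λ} {[L_δ]_ε | δ = β/α with β ∈ [0, ½α] ∩ ℤ_α^{unit}}`. The `ℤ`-basis
`e(1 δ; 0 1)` of a full lattice `L_δ` with `δ = β/α ∈ [0, ½]`, `α ∈ ℕ`, `α | λ`, `β ∈ ℤ_{≥0}` and `(β, α) = 1` gives
rise to the matrix `M_δ` with […] `M_δ = (λ λδ; 0 0) = (λ λβ/α; 0 0)`.»; (chunk p0028) «**Theorem 9.1** (d) […]
`|G([Λ]_ε)| = φ(α)/2` if `α ≥ 3`, `1` if `α ∈ {1, 2}`»; (chunk p0029) «**Theorem 9.4.** Each conjugacy class of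
`2×2` matrices with eigenvalues `λ ∈ ℕ` and `0` has a unique representative `(λ μ; 0 0)` with `μ ∈ [0, ½λ] ∩ ℤ`.
This matrix comes from an `ε`-class of full lattices with order with `ℤ`-basis `e(α 1; 0 1)` where
`α = λ/(λ, μ)`.»

## What is proved

* §1 `forall_dvd_of_conj` / `forall_dvd_iff_of_conj` (the common divisors of the entries are a class invariant),
  `forall_dvd_normalForm_iff` (for `(t μ; 0 0)`: the common divisors of `t, μ`).
* §2 **EXAMPLE 9.3 + THEOREM 9.1 (d) in matrix terms, `natCard_quot_conj_stratum_eq`**: for `λ ≠ 0` and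
  `|λ| = gα`, the `GL₂(ℤ)`-classes of `B ∈ M_{2×2}(ℤ)` with `tr B = λ`, `det B = 0` and content `g` (order `Λ_α`)
  are in bijection with `{β | 2β ≤ α, gcd(α, β) = 1}` (representatives `M_{β/α} = (λ gβ; 0 0)`), hence number
  `φ(α)/2` (`α ≥ 3`), `1` (`α ∈ {1, 2}`).
* §3 `sum_divisors_strata_eq`: `Σ_{α | n} (φ(α)/2, resp. 1) = ⌊n/2⌋ + 1` (`n ≥ 1`) — the strata of Example 9.3 add
  up to the `⌊λ/2⌋ + 1` representatives of Theorem 9.4 (`GL2ZSingularNormalForms.natCard_quot_conj_eq`); from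
  `Σ_{α|n} φ(α) = n` and `2 | φ(α)` for `α ≥ 3`.

## References

* [HertlingLarabi2026b] C. Hertling, K. Larabi, *Conjugacy classes of regular integer matrices*, arXiv:2602.15748
  (2026), §9.2 Example 9.3, Theorem 9.1 (d), Theorem 9.4 (chunks p0028–p0029). [cite: HertlingLarabi2026b, §9.2
  Example 9.3; Thm. 9.1 (d); Thm. 9.4]
* [HertlingLarabi2026] C. Hertling, K. Larabi, *Semigroups from full lattices in commutative ℚ-algebras*,
  arXiv:2602.14973 (2026) (orders, `ε`-classes, `G([Λ]_ε)`).
-/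

open Matrix

namespace Literature.LinearAlgebra.Matrix.GL2ZSingularNormalForm

open Literature.NumberTheory.ComplexMultiplication.FiniteQAlgebraLattice (natCard_two_mul_le_coprime
  card_filter_two_mul_le_coprime)

/-! ## §1 The content of a class (`gcd` of the entries) — the matrix form of the order invariant `α = λ/(λ, μ)` -/

/-- Symmetry of `GL₂(ℤ)`-conjugacy (file-local). [folklore] -/
private theorem conj_symm' {B B' : Matrix (Fin 2) (Fin 2) ℤ}
    (h : ∃ P : Matrix (Fin 2) (Fin 2) ℤ, IsUnit P.det ∧ P * B = B' * P) :
    ∃ P : Matrix (Fin 2) (Fin 2) ℤ, IsUnit P.det ∧ P * B' = B * P := by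
  obtain ⟨P, hP, hPB⟩ := h
  refine ⟨P⁻¹, Matrix.isUnit_nonsing_inv_det P hP, ?_⟩
  calc P⁻¹ * B' = P⁻¹ * B' * (P * P⁻¹) := by rw [Matrix.mul_nonsing_inv P hP, Matrix.mul_one]
    _ = P⁻¹ * (B' * P) * P⁻¹ := by simp only [Matrix.mul_assoc]
    _ = P⁻¹ * (P * B) * P⁻¹ := by rw [hPB]
    _ = B * P⁻¹ := by rw [← Matrix.mul_assoc, Matrix.nonsing_inv_mul P hP, Matrix.one_mul]

/-- **A common divisor of the entries survives conjugation**: if `PB = B'P` with `P ∈ GL₂(ℤ)` and `d` divides every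
entry of `B`, then `d` divides every entry of `B' = P(dB₀)P⁻¹ = d·PB₀P⁻¹` (HL: `(λ, μ)` in `α = λ/(λ, μ)` is an
invariant of the class, Thm. 9.4 / Rem. 6.3 (v)). [cite: HertlingLarabi2026b, §9.2 Theorem 9.4 and Example 9.3, chunks
p0028–p0029] -/
theorem forall_dvd_of_conj {B B' P : Matrix (Fin 2) (Fin 2) ℤ} (hP : IsUnit P.det) (h : P * B = B' * P) {d : ℤ}
    (hd : ∀ i j, d ∣ B i j) : ∀ i j, d ∣ B' i j := by
  obtain ⟨B₀, rfl⟩ : ∃ B₀ : Matrix (Fin 2) (Fin 2) ℤ, B = d • B₀ :=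
    ⟨Matrix.of fun i j => Classical.choose (hd i j), by
      ext i j
      rw [Matrix.smul_apply, Matrix.of_apply, smul_eq_mul]
      exact Classical.choose_spec (hd i j)⟩
  have hB' : B' = P * (d • B₀) * P⁻¹ := by
    calc B' = B' * (P * P⁻¹) := by rw [Matrix.mul_nonsing_inv P hP, Matrix.mul_one]
      _ = B' * P * P⁻¹ := by rw [Matrix.mul_assoc]
      _ = P * (d • B₀) * P⁻¹ := by rw [← h]
  intro i j
  rw [hB', Matrix.mul_smul, Matrix.smul_mul, Matrix.smul_apply, smul_eq_mul]
  exact dvd_mul_right d _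

/-- The set of common divisors of the entries is a `GL₂(ℤ)`-conjugacy invariant. [cite: HertlingLarabi2026b, §9.2
Theorem 9.4 and Example 9.3, chunks p0028–p0029] -/
theorem forall_dvd_iff_of_conj {B B' P : Matrix (Fin 2) (Fin 2) ℤ} (hP : IsUnit P.det) (h : P * B = B' * P) (d : ℤ) :
    (∀ i j, d ∣ B i j) ↔ ∀ i j, d ∣ B' i j := by
  refine ⟨forall_dvd_of_conj hP h, fun hd => ?_⟩
  obtain ⟨Q, hQ, hQ'⟩ := conj_symm' ⟨P, hP, h⟩
  exact forall_dvd_of_conj hQ hQ' hd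

/-- The common divisors of the entries of the normal form `(t μ; 0 0)` are the common divisors of `t` and `μ`.
[cite: HertlingLarabi2026b, §9.2 Theorem 9.4, chunk p0029] -/
theorem forall_dvd_normalForm_iff (t μ d : ℤ) :
    (∀ i j, d ∣ (!![t, μ; 0, 0] : Matrix (Fin 2) (Fin 2) ℤ) i j) ↔ d ∣ t ∧ d ∣ μ := by
  constructor
  · intro h
    exact ⟨by simpa using h 0 0, by simpa using h 0 1⟩
  · rintro ⟨ht, hμ⟩ i j
    fin_cases i <;> fin_cases j <;> simp [ht, hμ]

/-- `g = gcd(a, b)` iff the common divisors of `a, b` are the divisors of `g` (`g ∈ ℕ`). [folklore] -/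
private theorem forall_dvd_and_dvd_iff_iff_gcd_eq (a b : ℤ) (g : ℕ) :
    (∀ d : ℤ, (d ∣ a ∧ d ∣ b) ↔ d ∣ (g : ℤ)) ↔ Int.gcd a b = g := by
  constructor
  · intro h
    apply Nat.dvd_antisymm
    · exact Int.natCast_dvd_natCast.1 ((h _).1 ⟨Int.gcd_dvd_left a b, Int.gcd_dvd_right a b⟩)
    · obtain ⟨ha, hb⟩ := (h g).2 (dvd_refl _)
      exact Int.dvd_gcd ha hb
  · rintro rfl d
    exact ⟨fun ⟨ha, hb⟩ => Int.dvd_coe_gcd ha hb,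
      fun hd => ⟨hd.trans (Int.gcd_dvd_left a b), hd.trans (Int.gcd_dvd_right a b)⟩⟩

/-- `gcd(gα, m) = g` iff `m = gβ` with `gcd(α, β) = 1` (`g > 0`). [folklore] -/
private theorem gcd_mul_eq_iff {g α m : ℕ} (hg : 0 < g) :
    Nat.gcd (g * α) m = g ↔ g ∣ m ∧ α.Coprime (m / g) := by
  constructor
  · intro h
    have hgm : g ∣ m := h ▸ Nat.gcd_dvd_right _ _
    obtain ⟨β, rfl⟩ := hgm
    rw [Nat.gcd_mul_left] at h
    refine ⟨dvd_mul_right g β, ?_⟩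
    rw [Nat.mul_div_cancel_left β hg]
    exact Nat.eq_of_mul_eq_mul_left hg (h.trans (mul_one g).symm)
  · rintro ⟨⟨β, rfl⟩, hcop⟩
    rw [Nat.mul_div_cancel_left β hg] at hcop
    rw [Nat.gcd_mul_left, hcop, mul_one]

/-! ## §2 EXAMPLE 9.3: the classes with eigenvalues `λ`, `0` and order `Λ_α`, `α | λ` -/

/-- **EXAMPLE 9.3** «the conjugacy classes of integer `2×2` matrices with eigenvalues `λ` and `0` correspond to the
`ε`-classes of full lattices `L` with `𝒪(L) ⊃ Λ` […] `{[L]_ε | 𝒪(L) ⊃ Λ} = ⋃_{α ∈ ℕ: α|λ} {[L_δ]_ε | δ = β/α` with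
`β ∈ [0, ½α] ∩ ℤ_α^{unit}}`» with THEOREM 9.1 (d) «`|G([Λ]_ε)| = φ(α)/2` if `α ≥ 3`, `1` if `α ∈ {1, 2}`», in
matrix terms: for `λ ≠ 0` and a factorisation `|λ| = gα`, the `GL₂(ℤ)`-classes of integer matrices `B` with
`tr B = λ`, `det B = 0` whose entries have greatest common divisor `g` (equivalently — `GL2ZSingularNormalForms` §5
— whose order is `ℤ·1 + ℤ·t̄/g ≅ Λ_α`) are in bijection with `{β | 2β ≤ α, gcd(α, β) = 1}` (representatives
`(λ gβ; 0 0)`), so there are `φ(α)/2` of them if `α ≥ 3` and `1` if `α ∈ {1, 2}`.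
[cite: HertlingLarabi2026b, §9.2 Example 9.3 and Theorem 9.4 (chunks p0028–p0029), Theorem 9.1 (d) (chunk p0028)] -/
theorem natCard_quot_conj_stratum_eq {t : ℤ} (ht : t ≠ 0) {g α : ℕ} (hgα : t.natAbs = g * α) :
    Nat.card (Quot fun B B' : {B : Matrix (Fin 2) (Fin 2) ℤ // B.trace = t ∧ B.det = 0 ∧
        ∀ d : ℤ, (∀ i j, d ∣ B i j) ↔ d ∣ (g : ℤ)} =>
      ∃ P : Matrix (Fin 2) (Fin 2) ℤ, IsUnit P.det ∧ P * B.1 = B'.1 * P) = if α ≤ 2 then 1 else Nat.totient α / 2 := by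
  classical
  have hg : 0 < g := Nat.pos_of_ne_zero fun h => by
    rw [h, zero_mul] at hgα; exact ht (Int.natAbs_eq_zero.1 hgα)
  have hα : 0 < α := Nat.pos_of_ne_zero fun h => by
    rw [h, mul_zero] at hgα; exact ht (Int.natAbs_eq_zero.1 hgα)
  set S := {B : Matrix (Fin 2) (Fin 2) ℤ // B.trace = t ∧ B.det = 0 ∧ ∀ d : ℤ, (∀ i j, d ∣ B i j) ↔ d ∣ (g : ℤ)}
    with hS
  set r : S → S → Prop := fun B B' => ∃ P : Matrix (Fin 2) (Fin 2) ℤ, IsUnit P.det ∧ P * B.1 = B'.1 * P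
    with hr_def
  have hr : Equivalence r := LatimerMacDuffeeOrderStrata.equivalence_conj _
  -- the content condition on a normal form `(t m; 0 0)`: `gcd(t, m) = g`, i.e. `m = gβ`, `gcd(α, β) = 1`
  have hcontent : ∀ m : ℕ, (∀ d : ℤ, (∀ i j, d ∣ (!![t, (m : ℤ); 0, 0] : Matrix (Fin 2) (Fin 2) ℤ) i j) ↔
      d ∣ (g : ℤ)) ↔ g ∣ m ∧ α.Coprime (m / g) := fun m => by
    simp only [forall_dvd_normalForm_iff]
    rw [forall_dvd_and_dvd_iff_iff_gcd_eq, Int.gcd_eq_natAbs, hgα, Int.natAbs_natCast, gcd_mul_eq_iff hg]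
  -- the normal forms `(t gβ; 0 0)` as elements of `S`
  have hN : ∀ β : ℕ, α.Coprime β → (!![t, ((g * β : ℕ) : ℤ); 0, 0] : Matrix (Fin 2) (Fin 2) ℤ).trace = t ∧
      (!![t, ((g * β : ℕ) : ℤ); 0, 0] : Matrix (Fin 2) (Fin 2) ℤ).det = 0 ∧
      ∀ d : ℤ, (∀ i j, d ∣ (!![t, ((g * β : ℕ) : ℤ); 0, 0] : Matrix (Fin 2) (Fin 2) ℤ) i j) ↔ d ∣ (g : ℤ) := by
    intro β hcop
    refine ⟨by rw [Matrix.trace_fin_two_of, add_zero], by rw [Matrix.det_fin_two_of]; ring, ?_⟩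
    rw [hcontent, Nat.mul_div_cancel_left β hg]
    exact ⟨dvd_mul_right g β, hcop⟩
  set N : {β : ℕ // 2 * β ≤ α ∧ α.Coprime β} → S := fun β => ⟨!![t, ((g * β.1 : ℕ) : ℤ); 0, 0], hN β.1 β.2.2⟩
    with hN_def
  have hex : ∀ B : S, ∃ β : {β : ℕ // 2 * β ≤ α ∧ α.Coprime β}, r B (N β) := by
    rintro ⟨B, hBt, hBd, hBc⟩
    have ht' : B.trace ≠ 0 := by rw [hBt]; exact ht
    obtain ⟨m, hm, P, hP, hPB⟩ := exists_conj_normalForm hBd ht'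
    rw [hBt] at hm hPB
    -- the content of `(t m; 0 0)` is that of `B`, namely `g`
    have hc : ∀ d : ℤ, (∀ i j, d ∣ (!![t, (m : ℤ); 0, 0] : Matrix (Fin 2) (Fin 2) ℤ) i j) ↔ d ∣ (g : ℤ) :=
      fun d => by rw [← forall_dvd_iff_of_conj hP hPB d, hBc d]
    rw [hcontent] at hc
    obtain ⟨⟨β, rfl⟩, hcop⟩ := hc
    rw [Nat.mul_div_cancel_left β hg] at hcop
    refine ⟨⟨β, ?_, hcop⟩, P, hP, hPB⟩
    rw [hgα] at hm
    exact Nat.le_of_mul_le_mul_left (by linarith) hg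
  choose f hf using hex
  have hU : ∀ β β' : {β : ℕ // 2 * β ≤ α ∧ α.Coprime β}, r (N β) (N β') → β = β' := by
    rintro ⟨β, h2β, hβ⟩ ⟨β', h2β', hβ'⟩ ⟨P, hP, h⟩
    have h1 : 2 * (g * β) ≤ t.natAbs := by rw [hgα]; nlinarith
    have h2 : 2 * (g * β') ≤ t.natAbs := by rw [hgα]; nlinarith
    have := normalForm_unique ht h1 h2 hP h
    exact Subtype.ext (Nat.eq_of_mul_eq_mul_left hg this)
  have hwd : ∀ B B' : S, r B B' → f B = f B' := fun B B' h =>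
    hU _ _ (hr.trans (hr.trans (hr.symm (hf B)) h) (hf B'))
  have hbij : Function.Bijective (Quot.lift f hwd) := by
    constructor
    · rintro ⟨B⟩ ⟨B'⟩ h
      change f B = f B' at h
      exact Quot.sound (hr.trans (hf B) (h ▸ hr.symm (hf B')))
    · intro β
      exact ⟨Quot.mk r (N β), hU _ _ (hr.trans (hr.symm (hf (N β))) (hr.refl _))⟩
  rw [Nat.card_eq_of_bijective _ hbij]
  exact natCard_two_mul_le_coprime hα

/-! ## §3 `Σ_{α | n} ⌈φ(α)/2⌉ = ⌊n/2⌋ + 1`: the strata add up to the count of Theorem 9.4 -/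

/-- **The strata add up** (Example 9.3's «`⋃_{α ∈ ℕ: α|λ}`» against Theorem 9.4's `⌊λ/2⌋ + 1` representatives): for
`n ≥ 1`, `Σ_{α | n} c(α) = ⌊n/2⌋ + 1` where `c(α) = φ(α)/2` for `α ≥ 3` and `c(1) = c(2) = 1` — from Gauß'
`Σ_{α | n} φ(α) = n` (Mathlib `Nat.sum_totient`) and the parity of `φ`. [cite: HertlingLarabi2026b, §9.2 Example 9.3
and Theorem 9.4, chunks p0028–p0029] -/
theorem sum_divisors_strata_eq (n : ℕ) (hn : 0 < n) :
    ∑ α ∈ n.divisors, (if α ≤ 2 then 1 else Nat.totient α / 2) = n / 2 + 1 := by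
  -- `2·c(α) = φ(α) + [α ≤ 2]`
  have hc : ∀ α ∈ n.divisors, 2 * (if α ≤ 2 then 1 else Nat.totient α / 2) =
      Nat.totient α + (if α ≤ 2 then 1 else 0) := by
    intro α hα
    have hα0 : 0 < α := Nat.pos_of_mem_divisors hα
    split_ifs with h2
    · interval_cases α <;> decide
    · push Not at h2
      obtain ⟨k, hk⟩ := Nat.totient_even h2
      omega
  have h2sum : 2 * ∑ α ∈ n.divisors, (if α ≤ 2 then 1 else Nat.totient α / 2) =
      n + ∑ α ∈ n.divisors, (if α ≤ 2 then 1 else 0) := by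
    rw [Finset.mul_sum, Finset.sum_congr rfl hc, Finset.sum_add_distrib, Nat.sum_totient]
  -- the divisors `≤ 2` of `n` are `1` and, for even `n`, `2`
  have hsmall : ∑ α ∈ n.divisors, (if α ≤ 2 then 1 else 0) = if 2 ∣ n then 2 else 1 := by
    rw [Finset.sum_boole, Nat.cast_id]
    have hfilter : n.divisors.filter (fun α => α ≤ 2) = if 2 ∣ n then {1, 2} else {1} := by
      ext α
      simp only [Finset.mem_filter, Nat.mem_divisors]
      split_ifs with h2 <;> simp only [Finset.mem_insert, Finset.mem_singleton]
      · constructor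
        · rintro ⟨⟨hd, -⟩, hα⟩
          have : α ≠ 0 := by
            rintro rfl
            rw [zero_dvd_iff] at hd
            omega
          omega
        · rintro (rfl | rfl)
          · exact ⟨⟨one_dvd n, hn.ne'⟩, by norm_num⟩
          · exact ⟨⟨h2, hn.ne'⟩, le_rfl⟩
      · constructor
        · rintro ⟨⟨hd, -⟩, hα⟩
          have : α ≠ 0 := by
            rintro rfl
            rw [zero_dvd_iff] at hd
            omega
          have : α ≠ 2 := by rintro rfl; exact h2 hd
          omega
        · rintro rfl
          exact ⟨⟨one_dvd n, hn.ne'⟩, by norm_num⟩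
    rw [hfilter]
    split_ifs <;> simp
  rw [hsmall] at h2sum
  split_ifs at h2sum with h2 <;> omega

end Literature.LinearAlgebra.Matrix.GL2ZSingularNormalForm
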